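import Summits.ABC.ABC.Theses.CuspFieldPencil
import Summits.ABC.ABC.Theorems.CuspFieldPencilGoldenFromNFPencil
import Summits.ABC.ABC.Theorems.YuMatveevShapeRatCloses
import Literature.NumberTheory.DiophantineGeometry.PastenSubexpPlaces
import Literature.NumberTheory.DiophantineGeometry.AbcTwoAdicValuationProofs
import Literature.Barriers.ABC.BakerMethodBoundsThreeRoutesProofs
import HarnessLib

/-!
# Sketch (stub-ideation k=2, gen 2 — FAMILY 2 RESHAPE) for `stub_conjugateCuspTriple`
(crux stmt-ABC-26026 `GoldenCuspShadow`, route CuspFieldPencil).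

RESHAPE TO ℚ: the crux `GoldenCuspShadow` (exponent `1/2 + ε`) follows UNCONDITIONALLY from the
kernel theorem `Summit.ABC.ABC.Theorems.approximationBound_rat_holds` (`∃ K ≥ 1, PastenApproximationBound K`)
applied through `Pasten.approx_div` to the two auxiliary coprime ℤ-identities
`Q + w² = u(u − 11w)` and `u² − Q = w(11u + w)` (`Q = u² − 11uw − w²`):
the `p`-adic clause at `p ∣ u` (resp. `p ∣ w`) and the archimedean clause carry Pasten's `Θ`
over the primes of `Q·w` (resp. `Q·u`) ONLY — the junk members `u − 11w`, `11u + w` sit on the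
valuation side / are bounded by `12·max(|u|,|w|)`. Result `UWHalf`:
`log max(|u|,|w|) ≪_δ R^δ · min(rad u, rad w)`, and `min(rad u, rad w) ≤ (rad u·rad w)^{1/2} ≤ R^{1/2}`.
Statements only (`sorry` bodies) except the ring identities and the final compositions.
-/

set_option linter.dupNamespace false
set_option linter.unusedVariables false

noncomputable section

open Finset Real Height UniqueFactorizationMonoid
open Literature.NumberTheory.DiophantineGeometry
open Literature.NumberTheory.DiophantineGeometry.Dioph
open Literature.NumberTheory.DiophantineGeometry.Pasten
open Literature.Barriers.ABC

namespace Summit.ABC.ABC.Cruxes.GoldenCuspShadow.SideaK2G2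

/-- The registered stub signature, verbatim (`Sig.stub_conjugateCuspTriple` of the birth skeleton). -/
def StubConjugate : Prop :=
  ∀ ε : ℝ, 0 < ε → ∃ κ : ℝ, ∀ u w : ℤ, IsCoprime u w → u * w * (u ^ 2 - 11 * u * w - w ^ 2) ≠ 0 → Real.log (max (|(u : ℝ)|) (|(w : ℝ)|)) ≤ κ * (((UniqueFactorizationMonoid.radical (u * w * (u ^ 2 - 11 * u * w - w ^ 2))).natAbs : ℕ) : ℝ) ^ (ε : ℝ) * ((((UniqueFactorizationMonoid.radical (u ^ 2 - 11 * u * w - w ^ 2)).natAbs : ℕ) : ℝ) ^ (2 / 3 : ℝ) * (min (((UniqueFactorizationMonoid.radical u).natAbs : ℕ) : ℝ) (((UniqueFactorizationMonoid.radical w).natAbs : ℕ) : ℝ)) ^ (2 / 3 : ℝ))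

/-- A1. The ℚ-side target `UWHalf`: `log max(|u|,|w|) ≤ κ_δ · R^δ · min(rad u, rad w)` for every `δ > 0`
(`R = rad(uwQ)`). The factor `R^δ` is load-bearing (`δ = 0` is false on the slice `w = 1`). -/
def UWHalf : Prop :=
  ∀ δ : ℝ, 0 < δ → ∃ κ : ℝ, ∀ u w : ℤ, IsCoprime u w → u * w * (u ^ 2 - 11 * u * w - w ^ 2) ≠ 0 →
    Real.log (max (|(u : ℝ)|) (|(w : ℝ)|)) ≤
      κ * (((radical (u * w * (u ^ 2 - 11 * u * w - w ^ 2))).natAbs : ℕ) : ℝ) ^ δ *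
        min (((radical u).natAbs : ℕ) : ℝ) (((radical w).natAbs : ℕ) : ℝ)

/-! ### H1 — the two auxiliary ℤ-identities and the `u ↔ w` symmetry (all `ring`) -/

/-- `Q + w² = u(u − 11w)`. -/
theorem aux_triple_u (u w : ℤ) : (u ^ 2 - 11 * u * w - w ^ 2) + w ^ 2 = u * (u - 11 * w) := by ring

/-- `u² − Q = w(11u + w)`. -/
theorem aux_triple_w (u w : ℤ) : u ^ 2 - (u ^ 2 - 11 * u * w - w ^ 2) = w * (11 * u + w) := by ring

/-- `(u,w) ↦ (w,−u)`: `Q ↦ −Q`. -/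
theorem symm_Q (u w : ℤ) : w ^ 2 - 11 * w * (-u) - (-u) ^ 2 = -(u ^ 2 - 11 * u * w - w ^ 2) := by ring

/-- `(u,w) ↦ (w,−u)`: `uwQ` is invariant. -/
theorem symm_prod (u w : ℤ) :
    w * (-u) * (w ^ 2 - 11 * w * (-u) - (-u) ^ 2) = u * w * (u ^ 2 - 11 * u * w - w ^ 2) := by ring

/-- `(u,w) ↦ (w,−u)`: the junk members swap, `w − 11(−u) = 11u + w`, `11w + (−u) = −(u − 11w)`. -/
theorem symm_junk (u w : ℤ) : w - 11 * (-u) = 11 * u + w ∧ 11 * w + (-u) = -(u - 11 * w) := by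
  constructor <;> ring

/-! ### H2 — coprimality and (non)degeneracy -/

/-- H2a: `gcd(|Q|, w²) = 1` and `gcd(|Q|, u²) = 1` as natural numbers (from
`GoldenFromNFPencil.isCoprime_quadForm_right/left`, `Int.isCoprime_iff_gcd_eq_one`, `Nat.Coprime.pow_right`). -/
theorem natAbs_Q_coprime_sq {u w : ℤ} (hcop : IsCoprime u w) :
    ((u ^ 2 - 11 * u * w - w ^ 2).natAbs).Coprime (w.natAbs ^ 2) ∧
      ((u ^ 2 - 11 * u * w - w ^ 2).natAbs).Coprime (u.natAbs ^ 2) := by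
  sorry

/-- H2b: the degenerate pairs (`u = 11w` or `11u + w = 0`) are `(±11, ±1)`, `(±1, ∓11)`: `max |u| |w| = 11`. -/
theorem degenerate_max_eq {u w : ℤ} (hcop : IsCoprime u w) (h : u - 11 * w = 0 ∨ 11 * u + w = 0) :
    max (|(u : ℝ)|) (|(w : ℝ)|) = 11 := by
  sorry

/-- H2c: in the nondegenerate case `|Q|·w² > 1` and `|Q|·u² > 1` (the `1 < u·v` hypothesis of `approx_div`;
`|Q| = |w| = 1` forces `(u,w) = (±11, ±1)`, `|Q| = |u| = 1` forces `(±1, ∓11)`). -/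
theorem one_lt_natAbs_Q_mul_sq {u w : ℤ} (hcop : IsCoprime u w)
    (hne : u * w * (u ^ 2 - 11 * u * w - w ^ 2) ≠ 0) (hu : u - 11 * w ≠ 0) (hw : 11 * u + w ≠ 0) :
    1 < (u ^ 2 - 11 * u * w - w ^ 2).natAbs * w.natAbs ^ 2 ∧
      1 < (u ^ 2 - 11 * u * w - w ^ 2).natAbs * u.natAbs ^ 2 := by
  sorry

/-- H2d: `|Q| ≤ 13·max(|u|,|w|)²`, whence `h(±|Q|/w²), h(±|Q|/u²) ≤ log 13 + 4·log max(|u|,|w|)`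
(`logHeight₁_sign_mul_div_le`). -/
theorem logHeight₁_Q_div_sq_le {u w : ℤ} (hne : u * w * (u ^ 2 - 11 * u * w - w ^ 2) ≠ 0)
    {v : ℤ} (hv : v = u ∨ v = w) {ζ : ℚ} (hζ : ζ = 1 ∨ ζ = -1) :
    logHeight₁ (ζ * ((((u ^ 2 - 11 * u * w - w ^ 2).natAbs : ℕ) : ℚ) / ((v.natAbs ^ 2 : ℕ) : ℚ))) ≤
      Real.log 13 + 4 * Real.log (max (|(u : ℝ)|) (|(w : ℝ)|)) := by
  sorry

/-! ### H3 — the `p`-adic clause at the primes of `u` (and, by symmetry, of `w`) -/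

/-- H3u: `log|u| ≤ 3·Θ_{|Q|,w²}·Y·∑_{p∣u} p` with `Y = log max(e, log 13 + 4 log H)`.
From `approx_div hK hP` at `u := |Q|, v := w², N := 0, ζ := −sign Q` (`1 − ξ = u(u−11w)/w²`, so
`padicValRat p (1 − ξ) = ν_p(u) + ν_p(u − 11w) ≥ ν_p(u)` for `p ∣ u`, `p ∤ w`), then
`log_max_exp_mul_le`, `div_log_mul_add_le`, `log_eq_sum_factorization_mul_log` — verbatim the pattern of
`Literature.Barriers.ABC.log_lt_route_c`. -/
theorem log_natAbs_u_le {K : ℝ} (hK : 1 ≤ K) (hP : PastenApproximationBound K) {u w : ℤ}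
    (hcop : IsCoprime u w) (hne : u * w * (u ^ 2 - 11 * u * w - w ^ 2) ≠ 0)
    (hu : u - 11 * w ≠ 0) (hw : 11 * u + w ≠ 0) :
    Real.log (u.natAbs : ℝ) ≤
      3 * theta K (u ^ 2 - 11 * u * w - w ^ 2).natAbs (w.natAbs ^ 2) 0 *
        Real.log (max (Real.exp 1) (Real.log 13 + 4 * Real.log (max (|(u : ℝ)|) (|(w : ℝ)|)))) *
        ∑ p ∈ u.natAbs.primeFactors, (p : ℝ) := by
  sorry

/-- H3w (from H3u at `(w, −u)` via `symm_Q`, `symm_prod`, `symm_junk`, `Int.natAbs_neg`, `max_comm`). -/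
theorem log_natAbs_w_le {K : ℝ} (hK : 1 ≤ K) (hP : PastenApproximationBound K) {u w : ℤ}
    (hcop : IsCoprime u w) (hne : u * w * (u ^ 2 - 11 * u * w - w ^ 2) ≠ 0)
    (hu : u - 11 * w ≠ 0) (hw : 11 * u + w ≠ 0) :
    Real.log (w.natAbs : ℝ) ≤
      3 * theta K (u ^ 2 - 11 * u * w - w ^ 2).natAbs (u.natAbs ^ 2) 0 *
        Real.log (max (Real.exp 1) (Real.log 13 + 4 * Real.log (max (|(u : ℝ)|) (|(w : ℝ)|)))) *
        ∑ p ∈ w.natAbs.primeFactors, (p : ℝ) := by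
  sorry

/-! ### H4 — the archimedean clause (`ξ = Q/u²`, `1 − ξ = w(11u+w)/u²`, `|11u + w| ≤ 12|u|`) -/

/-- H4: for `|w| ≤ |u|`, `log|u| − log|w| ≤ log 12 + Θ_{|Q|,u²}·Y` (`approx_div` archimedean clause at
`u := |Q|, v := u², ζ := sign Q`; `−log|1 − ξ| = 2 log|u| − log|w| − log|11u+w|`). -/
theorem log_u_sub_log_w_le {K : ℝ} (hK : 1 ≤ K) (hP : PastenApproximationBound K) {u w : ℤ}
    (hcop : IsCoprime u w) (hne : u * w * (u ^ 2 - 11 * u * w - w ^ 2) ≠ 0)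
    (hu : u - 11 * w ≠ 0) (hw : 11 * u + w ≠ 0) (hle : |w| ≤ |u|) :
    Real.log (u.natAbs : ℝ) - Real.log (w.natAbs : ℝ) ≤ Real.log 12 +
      theta K (u ^ 2 - 11 * u * w - w ^ 2).natAbs (u.natAbs ^ 2) 0 *
        Real.log (max (Real.exp 1) (Real.log 13 + 4 * Real.log (max (|(u : ℝ)|) (|(w : ℝ)|)))) := by
  sorry

/-! ### H5 — absorbing Pasten's `Θ` at threshold `0` into `R^δ` -/

/-- H5: `theta K a b 0 = K^{ω(ab)+1}·∏_{p∣ab} log p ≤ C_δ·(∏_{p∣ab} p)^δ` uniformly in coprime nonzero `a, b`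
(`theta_zero_eq`, `pow_succ`, `exists_pow_card_primeFactors_le_mul_rpow`, `exists_prod_log_primeFactors_le_mul_rpow`
at `δ/2` each). -/
theorem exists_theta_zero_le_rpow {K : ℝ} (hK : 1 ≤ K) {δ : ℝ} (hδ : 0 < δ) :
    ∃ C : ℝ, 1 ≤ C ∧ ∀ a b : ℕ, a ≠ 0 → b ≠ 0 → a.Coprime b →
      theta K a b 0 ≤ C * (∏ p ∈ (a * b).primeFactors, (p : ℝ)) ^ δ := by
  sorry

/-! ### H6 — radical bookkeeping -/

/-- H6a: `(rad z).natAbs = ∏_{p ∣ |z|} p` (`Int.radical_natAbs_eq_radical`, `Nat.radical_eq_prod_primeFactors`). -/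
theorem natAbs_radical_eq_prod (z : ℤ) :
    (((radical z).natAbs : ℕ) : ℝ) = ∏ p ∈ z.natAbs.primeFactors, (p : ℝ) := by
  sorry

/-- H6b: `∑_{p∣n} p ≤ ∏_{p∣n} p` (every prime is `≥ 2`; induction on the finset). -/
theorem sum_primeFactors_le_prod (n : ℕ) :
    ∑ p ∈ n.primeFactors, (p : ℝ) ≤ ∏ p ∈ n.primeFactors, (p : ℝ) := by
  sorry

/-- H6c: the primes of `|Q|·v²` (`v ∈ {u, w}`) lie among those of `uwQ`: `∏_{p ∣ |Q|v²} p ≤ (rad(uwQ)).natAbs`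
(`Nat.primeFactors_mul`, `Nat.primeFactors_pow`, `Pasten.prod_primeFactors_le_radical`, `GoldenFromNFPencil.natAbs_radical_prod`). -/
theorem prod_primeFactors_Q_sq_le_radical {u w : ℤ} (hne : u * w * (u ^ 2 - 11 * u * w - w ^ 2) ≠ 0)
    {v : ℤ} (hv : v = u ∨ v = w) :
    (∏ p ∈ ((u ^ 2 - 11 * u * w - w ^ 2).natAbs * v.natAbs ^ 2).primeFactors, ((p : ℕ) : ℝ)) ≤
      (((radical (u * w * (u ^ 2 - 11 * u * w - w ^ 2))).natAbs : ℕ) : ℝ) := by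
  sorry

/-- H6d: `1 ≤ (rad v).natAbs ≤ (rad(uwQ)).natAbs` for `v ∈ {u, w}` (so `min(rad u, rad w) ≥ 1` and `≤ R`). -/
theorem one_le_natAbs_radical_le {u w : ℤ} (hcop : IsCoprime u w)
    (hne : u * w * (u ^ 2 - 11 * u * w - w ^ 2) ≠ 0) {v : ℤ} (hv : v = u ∨ v = w) :
    1 ≤ (radical v).natAbs ∧
      (radical v).natAbs ≤ (radical (u * w * (u ^ 2 - 11 * u * w - w ^ 2))).natAbs := by
  sorry

/-! ### H7 — self-improvement in `log H` (public version of the private `StewartYu2001.lt_two_mul_log_of_lt`) -/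

/-- H7: `X ≤ A·log max(e, log 13 + 4X)`, `A ≥ 1`, `X ≥ 0` ⟹ `X ≤ 8A·log(8A)`
(`t = log 13 + 4X ≤ 6.57·A·log t` and `log t ≤ √t` give `t ≤ 2M log M`, `M = 6.57A`). -/
theorem self_improve {X A : ℝ} (hA : 1 ≤ A) (hX : 0 ≤ X)
    (h : X ≤ A * Real.log (max (Real.exp 1) (Real.log 13 + 4 * X))) :
    X ≤ 8 * A * Real.log (8 * A) := by
  sorry

/-- H8 (by name, Mathlib): `log x ≤ x^δ/δ` is `Real.log_le_rpow_div`; recorded as the form used. -/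
theorem log_le_rpow_div' {x δ : ℝ} (hx : 0 ≤ x) (hδ : 0 < δ) : Real.log x ≤ x ^ δ / δ :=
  Real.log_le_rpow_div hx hδ

/-! ### Assembly -/

/-- A0 (K-parametric core, case `|w| ≤ |u|`, BEFORE self-improvement; `(v.natAbs : ℝ) = |(v:ℝ)|` is `Nat.cast_natAbs`):
`log|u| ≤ C_δ · R^δ · Y · min(rad u, rad w)` — from H3u+H6 (`≤ 3Θ₁Y·rad u`) and H4+H3w (`≤ log 12 + Θ₂Y + 3Θ₂Y·rad w`),
`Θᵢ ≤ C·R^δ` (H5+H6c), `Y, R^δ, rad ≥ 1`. The case `|u| ≤ |w|` is this one at `(w, −u)` (H1 symmetry, `radical_neg`,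
`IsCoprime.neg_right`, `abs_neg`, `max_comm`). -/
theorem log_le_pre {K : ℝ} (hK : 1 ≤ K) (hP : PastenApproximationBound K) {δ : ℝ} (hδ : 0 < δ) :
    ∃ C : ℝ, 1 ≤ C ∧ ∀ u w : ℤ, IsCoprime u w → u * w * (u ^ 2 - 11 * u * w - w ^ 2) ≠ 0 →
      u - 11 * w ≠ 0 → 11 * u + w ≠ 0 → |w| ≤ |u| →
      Real.log (|(u : ℝ)|) ≤
        C * (((radical (u * w * (u ^ 2 - 11 * u * w - w ^ 2))).natAbs : ℕ) : ℝ) ^ δ *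
          Real.log (max (Real.exp 1) (Real.log 13 + 4 * Real.log (max (|(u : ℝ)|) (|(w : ℝ)|)))) *
          min (((radical u).natAbs : ℕ) : ℝ) (((radical w).natAbs : ℕ) : ℝ) := by
  sorry

/-- A1 (the prover's target): `UWHalf` from H1–H8 and `approximationBound_rat_holds`
(`obtain ⟨K, hK, hP⟩ := Summit.ABC.ABC.Theorems.approximationBound_rat_holds`; degenerate pairs by H2b with `κ ≥ log 11`;
else case `|w| ≤ |u|`: `log H = log|u| ≤ 3Θ₁Y·rad u` (H3u+H6) and `log H ≤ log 12 + Θ₂Y + 3Θ₂Y·rad w` (H4+H3w),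
so `log H ≤ Y·(log 12 + 4C_δ R^δ)·min(rad u, rad w)`; symmetric case alike; then H7 and H8 turn `Y` into `R^δ`). -/
theorem uwHalf_proof : UWHalf := by
  sorry

/-- A2: `UWHalf → GoldenCuspShadow` (`min(rad u, rad w) ≤ ((rad u)(rad w))^{1/2} ≤ R^{1/2}` by
`GoldenFromNFPencil.natAbs_radical_prod`; take `δ := ε`, `κ := max κ_ε 0`, `Real.rpow_add`, `Real.sqrt`-free via `rpow_le_rpow`). -/
theorem goldenCuspShadow_of_uwHalf (h : UWHalf) :
    Summit.ABC.ABC.Theses.CuspFieldPencil.GoldenCuspShadow := by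
  sorry

/-- A2′ (kernel-checked composition modulo the sorried helpers): the crux, unconditionally over ℚ. -/
theorem goldenCuspShadow_via_Q : Summit.ABC.ABC.Theses.CuspFieldPencil.GoldenCuspShadow :=
  goldenCuspShadow_of_uwHalf uwHalf_proof

/-- A3 (what `UWHalf` gives toward the stub AS TYPED): the stub inequality in REGIME I
`min(rad u, rad w) ≤ rad(Q)²·R^ε` (take `δ := ε/2` in `UWHalf`: `R^{ε/2}·m ≤ R^ε·rad(Q)^{2/3}·m^{2/3}` iff
`m^{1/3} ≤ R^{ε/2} rad(Q)^{2/3}`). REGIME II (`rad Q` small, e.g. the unit family `Q = ±1`) is NOT reached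
over ℚ — it is the `k = 3` conjugate sub-pencil of `NFPencilBound` (ideators k1/k3, gen-1 k2 Plan A). -/
theorem stub_regimeI_of_uwHalf (h : UWHalf) :
    ∀ ε : ℝ, 0 < ε → ∃ κ : ℝ, ∀ u w : ℤ, IsCoprime u w → u * w * (u ^ 2 - 11 * u * w - w ^ 2) ≠ 0 →
      min (((radical u).natAbs : ℕ) : ℝ) (((radical w).natAbs : ℕ) : ℝ) ≤
          ((((radical (u ^ 2 - 11 * u * w - w ^ 2)).natAbs : ℕ) : ℝ)) ^ 2 *
            (((radical (u * w * (u ^ 2 - 11 * u * w - w ^ 2))).natAbs : ℕ) : ℝ) ^ ε →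
      Real.log (max (|(u : ℝ)|) (|(w : ℝ)|)) ≤
        κ * (((radical (u * w * (u ^ 2 - 11 * u * w - w ^ 2))).natAbs : ℕ) : ℝ) ^ (ε : ℝ) *
          ((((radical (u ^ 2 - 11 * u * w - w ^ 2)).natAbs : ℕ) : ℝ) ^ (2 / 3 : ℝ) *
            (min (((radical u).natAbs : ℕ) : ℝ) (((radical w).natAbs : ℕ) : ℝ)) ^ (2 / 3 : ℝ)) := by
  sorry

/-- Sanity: `StubConjugate` is literally the registered stub type (so a proof of it closes the stub by name). -/
example : StubConjugate =
    (∀ ε : ℝ, 0 < ε → ∃ κ : ℝ, ∀ u w : ℤ, IsCoprime u w → u * w * (u ^ 2 - 11 * u * w - w ^ 2) ≠ 0 → Real.log (max (|(u : ℝ)|) (|(w : ℝ)|)) ≤ κ * (((UniqueFactorizationMonoid.radical (u * w * (u ^ 2 - 11 * u * w - w ^ 2))).natAbs : ℕ) : ℝ) ^ (ε : ℝ) * ((((UniqueFactorizationMonoid.radical (u ^ 2 - 11 * u * w - w ^ 2)).natAbs : ℕ) : ℝ) ^ (2 / 3 : ℝ) * (min (((UniqueFactorizationMonoid.radical u).natAbs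 : ℕ) : ℝ) (((UniqueFactorizationMonoid.radical w).natAbs : ℕ) : ℝ)) ^ (2 / 3 : ℝ))) :=
  rfl

end Summit.ABC.ABC.Cruxes.GoldenCuspShadow.SideaK2G2

end
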